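import Summits.FinalStateConjecture.FinalStateConjecture.Theorems.PhotonSphereChannelsChannelsResolveTameDevelopmentsRFlatHorizonCriterion
import Literature.Geometry.Lorentzian.HypersurfaceRestriction
import Mathlib.Analysis.SpecialFunctions.Log.Deriv
import Mathlib.Analysis.Calculus.MeanValue
import HarnessLib

/-!
# Route PhotonSphereChannels · crux `ChannelsResolveTameDevelopmentsR` (K2R-T2, stmt-FinalStateConjecture-17430) ·
# line `tame-lasalle-dock` · stub D, clause (G6): the LAG CRITERION (how slowly the far frame may drift)

Sequel of `…RFlatHorizonCriterion` (p164621): there (G6) `IsMinkowski 𝓢 → E.horizon = ∅` was reduced to "the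
retarded time `u = x⁰ − ‖x̲‖` is unbounded above on the far chart", and proved from ONE subluminal observer. This file
weakens the kinematic input to the sharp LAG form and ties it to the far chart's data:

* §1 (Minkowski kinematics). For a curve `γ` in `ℝ⁴` with velocity `w(t)`, future timelike and UNIFORMLY so —
  `η(w, w) ≤ −m < 0`, `w⁰ ≥ 0` — the lag `w⁰ − ‖w̲‖` is at least `m / (2‖w‖)` (`lag_ge_of_bilin_le`); and the retarded
  time gains at least the integrated lag: if `g' ≤ w⁰ − ‖w̲‖` on `[0, ∞)` for an antiderivative `g`, then
  `u(γ(T)) ≥ u(γ(0)) + g(T) − g(0)` (`sub_norm_ge_of_hasDerivAt`, mean-value form — no integrals, no continuity of `w`).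
* §2 Hence LINEAR GROWTH of the velocity, `‖w(t)‖ ≤ K (1 + t)`, gives `u(γ(T)) ≥ u(γ(0)) + (m / 2K) log (1 + T) → ∞`
  (`forall_exists_lt_of_linear_growth`): the retarded time is unbounded along `γ`. (Bounded `‖w‖` = the subluminal case;
  a Rindler observer has `‖w‖ ~ e^{κt}`; the threshold is `∫ dt/‖w‖ = ∞`, e.g. rapidity `≤ log t + K`.)
* §3 The end form on Minkowski spacetime: for an end datum `E` whose far chart is smooth with `far_* ∂₀` future and
  `‖h‖ · r ≤ C` (`h = far^* η − g_{M,0}`, the `m = 0` clause of `far_bound`), the chart observer `t ↦ E.far (t, y)` at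
  ANY radius `‖y‖ ≥ 4 E.M + 2C` is uniformly timelike (`η(w, w) = −(1 − 2M/r) + h(∂₀, ∂₀) ≤ −1/2`); so if its chart
  velocity `dfar_{(t,y)} ∂₀` grows at most linearly in `t ≥ 0`, then `E.horizon = ∅`, the black-hole region of
  `range E.far` is empty and `E.doc = I⁺(range E.far)` (`horizon_eq_empty_of_linear_frame_growth`); the same from
  `E.IsTameEnd Λ r₀` (registered sub-goal `flatHorizonLag`).

So (G6) for a flat element fails ONLY IF the Lorentz factor of EVERY far-chart observer grows super-linearly in chart
time (integrably fast: `∫ dt/‖dfar ∂₀‖ < ∞`). The tame bounds alone (`‖D h‖ · r ≤ C`, no derivative gain) allow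
`‖dfar ∂₀‖ ≲ t^{c(C+M)}` by Grönwall along out–up–in paths (evidence note G6-FLAT-HORIZON-CRITERION-s64.md §2), so
(G6) follows for small `C + M` or with any first-order derivative gain; in the no-gain class it is the remaining
analytic residue of stub D. No route item is restated.

References: O'Neill 1983, Ch. 5, Lemma 5.29, p. 145; Ch. 14, pp. 402–403 [ONeill1983]; Wald 1984, §12.1 [Wald1984];
Rindler 2006, §3.8 (hyperbolic motion, event horizon of an accelerated observer) [Rindler2006].
-/

noncomputable section

set_option maxSynthPendingDepth 3
set_option linter.dupNamespace false

open Set Filter Function TopologicalSpace Manifold Bundle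
open scoped Topology Manifold ContDiff ENNReal NNReal RealInnerProductSpace

namespace Summit.FinalStateConjecture.FinalStateConjecture.Theorems.TameLaSalle.FlatHorizon

open Literature.Geometry.Lorentzian
open Summit.FinalStateConjecture.FinalStateConjecture.Theorems.TameHull

/-! ### §1 Minkowski kinematics: the lag of a uniformly timelike velocity -/

/-- **The lag of a uniformly timelike future vector.** If `η(w, w) ≤ −m` with `m ≥ 0` and `w⁰ ≥ 0`, then
`w⁰ − ‖w̲‖ ≥ m / (2‖w‖)`: indeed `(w⁰ − ‖w̲‖)(w⁰ + ‖w̲‖) = −η(w, w) ≥ m` and `0 ≤ w⁰ + ‖w̲‖ ≤ 2‖w‖`. (For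
`w = 0` both sides vanish, `m / 0 = 0`.) O'Neill 1983, Ch. 5, p. 145. [cite: ONeill1983, Ch. 5, p. 145] -/
theorem lag_ge_of_bilin_le {w : E4} {m : ℝ} (hm : 0 ≤ m) (hw : Minkowski.bilin w w ≤ -m) (h0 : 0 ≤ w 0) :
    m / (2 * ‖w‖) ≤ w 0 - ‖E4.spatial w‖ := by
  have hsq := Minkowski.norm_sq_eq_time_sq_add_norm_spatial_sq w
  -- `η(w, w) = −(w⁰)² + ‖w̲‖²` (as in `SwallowTheDatum.UniversalWitnessFamily.minkowski_self_eq`, not imported here)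
  have hbil : Minkowski.bilin w w = -(w 0) ^ 2 + ‖E4.spatial w‖ ^ 2 := by
    rw [Minkowski.bilin_apply, EuclideanSpace.real_norm_sq_eq]
    simp [pow_two]
  have hn0 : 0 ≤ ‖E4.spatial w‖ := norm_nonneg _
  have hnw : 0 ≤ ‖w‖ := norm_nonneg _
  -- `(w⁰)² ≥ ‖w̲‖² + m ≥ ‖w̲‖²`, so `w⁰ ≥ ‖w̲‖`
  have h1 : ‖E4.spatial w‖ ^ 2 + m ≤ (w 0) ^ 2 := by linarith
  have h2 : ‖E4.spatial w‖ ≤ w 0 := by nlinarith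
  have hw0 : w 0 ≤ ‖w‖ := by nlinarith
  have hws : ‖E4.spatial w‖ ≤ ‖w‖ := by nlinarith
  rcases eq_or_lt_of_le hnw with hz | hpos
  · -- `w = 0`
    have hw0' : w 0 = 0 := by linarith
    have hws' : ‖E4.spatial w‖ = 0 := by linarith
    rw [← hz, hw0', hws']
    simp
  · rw [div_le_iff₀ (by positivity)]
    nlinarith

/-- **Retarded time gains the integrated lag** (mean-value form). Let `γ : ℝ → ℝ⁴` have velocity `w(t)` at every
`t`, and let `g` be differentiable with `g'(t) ≤ w⁰(t) − ‖w̲(t)‖` for `t ≥ 0`. Then for `T ≥ 0`,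
`γ(T)⁰ − ‖γ̲(T)‖ ≥ γ(0)⁰ − ‖γ̲(0)‖ + (g(T) − g(0))`. Proof: with `ω` the unit vector of `γ̲(T) − γ̲(0)`, the function
`t ↦ γ(t)⁰ − ⟪ω, γ̲(t)⟫ − g(t)` has derivative `w⁰ − ⟪ω, w̲⟫ − g' ≥ w⁰ − ‖w̲‖ − g' ≥ 0`, hence is monotone on
`[0, T]`; and `‖γ̲(T)‖ ≤ ‖γ̲(0)‖ + ⟪ω, γ̲(T) − γ̲(0)⟫`. O'Neill 1983, Ch. 14, p. 402. [cite: ONeill1983, Ch. 14, p. 402] -/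
theorem sub_norm_ge_of_hasDerivAt {γ : ℝ → E4} {w : ℝ → E4} (hγ : ∀ t, HasDerivAt γ (w t) t)
    {g g' : ℝ → ℝ} (hg : ∀ t, 0 ≤ t → HasDerivAt g (g' t) t)
    (hlag : ∀ t, 0 ≤ t → g' t ≤ w t 0 - ‖E4.spatial (w t)‖) {T : ℝ} (hT : 0 ≤ T) :
    γ 0 0 - ‖E4.spatial (γ 0)‖ + (g T - g 0) ≤ γ T 0 - ‖E4.spatial (γ T)‖ := by
  -- the unit vector `e` of the spatial displacement (any unit-or-zero vector pairing to the norm will do)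
  set Δ : E3 := E4.spatial (γ T) - E4.spatial (γ 0) with hΔ
  obtain ⟨e, he1, heΔ⟩ : ∃ e : E3, ‖e‖ ≤ 1 ∧ @inner ℝ E3 _ e (Δ) = ‖Δ‖ := by
    rcases eq_or_ne Δ 0 with h0 | h0
    · exact ⟨0, by simp, by simp [h0]⟩
    · refine ⟨‖Δ‖⁻¹ • Δ, ?_, ?_⟩
      · rw [norm_smul, norm_inv, norm_norm, inv_mul_cancel₀ (norm_ne_zero_iff.2 h0)]
      · rw [real_inner_smul_left, real_inner_self_eq_norm_sq, pow_two, ← mul_assoc,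
          inv_mul_cancel₀ (norm_ne_zero_iff.2 h0), one_mul]
  -- the monotone function
  set F : ℝ → ℝ := fun t ↦ γ t 0 - @inner ℝ E3 _ e (E4.spatial (γ t)) - g t with hF
  have hF' : ∀ t, 0 ≤ t → HasDerivAt F (w t 0 - @inner ℝ E3 _ e (E4.spatial (w t)) - g' t) t := by
    intro t ht
    have h1 : HasDerivAt (fun s ↦ γ s 0) (w t 0) t := by
      have h := ((EuclideanSpace.proj (0 : Fin 4) : E4 →L[ℝ] ℝ).hasFDerivAt).comp_hasDerivAt t (hγ t)
      exact h
    have h2 : HasDerivAt (fun s ↦ @inner ℝ E3 _ e (E4.spatial (γ s))) (@inner ℝ E3 _ e (E4.spatial (w t))) t := by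
      have h := ((innerSL ℝ e).comp E4.spatial).hasFDerivAt.comp_hasDerivAt t (hγ t)
      exact h
    exact (h1.sub h2).sub (hg t ht)
  have hF'nonneg : ∀ t, 0 ≤ t → 0 ≤ w t 0 - @inner ℝ E3 _ e (E4.spatial (w t)) - g' t := by
    intro t ht
    have h1 : @inner ℝ E3 _ e (E4.spatial (w t)) ≤ ‖E4.spatial (w t)‖ := by
      calc @inner ℝ E3 _ e (E4.spatial (w t)) ≤ ‖e‖ * ‖E4.spatial (w t)‖ := real_inner_le_norm _ _
        _ ≤ 1 * ‖E4.spatial (w t)‖ := by gcongr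
        _ = ‖E4.spatial (w t)‖ := one_mul _
    linarith [hlag t ht]
  have hmono : MonotoneOn F (Icc 0 T) := by
    have hcont : ContinuousOn F (Icc 0 T) := fun t ht ↦ (hF' t ht.1).continuousAt.continuousWithinAt
    refine monotoneOn_of_hasDerivWithinAt_nonneg (convex_Icc 0 T) hcont (f' := fun t ↦
      w t 0 - @inner ℝ E3 _ e (E4.spatial (w t)) - g' t) (fun t ht ↦ ?_) (fun t ht ↦ ?_)
    · rw [interior_Icc] at ht
      exact (hF' t ht.1.le).hasDerivWithinAt
    · rw [interior_Icc] at ht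
      exact hF'nonneg t ht.1.le
  have hFT : F 0 ≤ F T := hmono ⟨le_rfl, hT⟩ ⟨hT, le_rfl⟩ hT
  simp only [hF] at hFT
  -- `‖γ̲(T)‖ ≤ ‖γ̲(0)‖ + ⟪e, Δ⟫`
  have hnorm : ‖E4.spatial (γ T)‖ ≤ ‖E4.spatial (γ 0)‖ + @inner ℝ E3 _ e (Δ) := by
    rw [heΔ]
    have := norm_add_le (E4.spatial (γ 0)) Δ
    rwa [show E4.spatial (γ 0) + Δ = E4.spatial (γ T) by rw [hΔ]; abel] at this
  have hinner : @inner ℝ E3 _ e (Δ) = @inner ℝ E3 _ e (E4.spatial (γ T)) - @inner ℝ E3 _ e (E4.spatial (γ 0)) := by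
    rw [hΔ, inner_sub_right]
  linarith

/-! ### §2 Linear growth of the velocity makes the retarded time unbounded -/

/-- **Linear growth of the velocity ⇒ logarithmic gain of retarded time.** If `γ` has velocity `w(t)` with
`η(w, w) ≤ −m < 0`, `w⁰ ≥ 0` and `‖w(t)‖ ≤ K (1 + t)` for `t ≥ 0`, then
`γ(T)⁰ − ‖γ̲(T)‖ ≥ γ(0)⁰ − ‖γ̲(0)‖ + (m / 2K) log (1 + T)` for `T ≥ 0`. Rindler 2006, §3.8 (the opposite regime:
an exponentially growing velocity leaves a horizon). [cite: Rindler2006, §3.8] -/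
theorem sub_norm_ge_log_of_linear_growth {γ : ℝ → E4} {w : ℝ → E4} (hγ : ∀ t, HasDerivAt γ (w t) t)
    {m K : ℝ} (hm : 0 < m) (hK : 0 < K) (hbil : ∀ t, 0 ≤ t → Minkowski.bilin (w t) (w t) ≤ -m)
    (h0 : ∀ t, 0 ≤ t → 0 ≤ w t 0) (hgr : ∀ t, 0 ≤ t → ‖w t‖ ≤ K * (1 + t)) {T : ℝ} (hT : 0 ≤ T) :
    γ 0 0 - ‖E4.spatial (γ 0)‖ + m / (2 * K) * Real.log (1 + T) ≤ γ T 0 - ‖E4.spatial (γ T)‖ := by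
  have hg : ∀ t, 0 ≤ t → HasDerivAt (fun s ↦ m / (2 * K) * Real.log (1 + s)) (m / (2 * K) * (1 + t)⁻¹) t := by
    intro t ht
    have h1 : HasDerivAt (fun s : ℝ ↦ 1 + s) 1 t := (hasDerivAt_id t).const_add 1
    have h2 := h1.log (by positivity)
    simpa using h2.const_mul (m / (2 * K))
  have hlag : ∀ t, 0 ≤ t → m / (2 * K) * (1 + t)⁻¹ ≤ w t 0 - ‖E4.spatial (w t)‖ := by
    intro t ht
    refine le_trans ?_ (lag_ge_of_bilin_le hm.le (hbil t ht) (h0 t ht))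
    -- `m / (2K(1+t)) ≤ m / (2‖w‖)` since `‖w‖ ≤ K (1 + t)` (and `w ≠ 0` as `η(w,w) ≤ −m < 0`)
    have hwpos : 0 < ‖w t‖ := by
      rcases (norm_nonneg (w t)).eq_or_lt with h | h
      · exfalso
        have hw0 : w t = 0 := norm_eq_zero.1 h.symm
        have := hbil t ht
        rw [hw0] at this
        simp at this
        linarith
      · exact h
    have hgt := hgr t ht
    calc m / (2 * K) * (1 + t)⁻¹ = m / (2 * (K * (1 + t))) := by
          field_simp
      _ ≤ m / (2 * ‖w t‖) := div_le_div_of_nonneg_left hm.le (by positivity) (by nlinarith)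
  have h := sub_norm_ge_of_hasDerivAt hγ hg hlag hT
  simpa using h

/-- **Linear growth of the velocity ⇒ the retarded time is unbounded along the curve.** Under the hypotheses of
`sub_norm_ge_log_of_linear_growth`, for every `c` some `T ≥ 0` has `γ(T)⁰ − ‖γ̲(T)‖ > c`. [cite: Rindler2006, §3.8] -/
theorem forall_exists_lt_of_linear_growth {γ : ℝ → E4} {w : ℝ → E4} (hγ : ∀ t, HasDerivAt γ (w t) t)
    {m K : ℝ} (hm : 0 < m) (hK : 0 < K) (hbil : ∀ t, 0 ≤ t → Minkowski.bilin (w t) (w t) ≤ -m)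
    (h0 : ∀ t, 0 ≤ t → 0 ≤ w t 0) (hgr : ∀ t, 0 ≤ t → ‖w t‖ ≤ K * (1 + t)) :
    ∀ c : ℝ, ∃ T : ℝ, 0 ≤ T ∧ c < γ T 0 - ‖E4.spatial (γ T)‖ := by
  intro c
  -- choose `T = exp A − 1` with `(m/2K) A = c − u(γ 0) + 1`, `A ≥ 0`
  set u0 : ℝ := γ 0 0 - ‖E4.spatial (γ 0)‖ with hu0
  set A : ℝ := max 0 ((c - u0 + 1) * (2 * K) / m) with hA
  have hA0 : 0 ≤ A := le_max_left _ _
  refine ⟨Real.exp A - 1, by linarith [Real.one_le_exp hA0], ?_⟩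
  have h := sub_norm_ge_log_of_linear_growth hγ hm hK hbil h0 hgr (T := Real.exp A - 1)
    (by linarith [Real.one_le_exp hA0])
  rw [show (1 : ℝ) + (Real.exp A - 1) = Real.exp A by ring, Real.log_exp] at h
  have hA1 : (c - u0 + 1) * (2 * K) / m ≤ A := le_max_right _ _
  have hmul : c - u0 + 1 ≤ m / (2 * K) * A := by
    rw [div_le_iff₀ hm] at hA1
    rw [div_mul_eq_mul_div, le_div_iff₀ (by positivity)]
    nlinarith
  linarith

/-! ### §3 The end form on Minkowski spacetime: one slowly drifting far-chart observer -/

section Ends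

/-- **The far chart lifts the coordinate time axis at `y` to a curve with velocity `dfar ∂₀`.** For an end datum
`E` of Minkowski spacetime with smooth far chart and `‖y‖ > max R 0`, the observer `t ↦ E.far (t, y)` (as a curve
in `ℝ⁴`; `id` retypes the value of the far chart as a vector of `E4`) has derivative `dfar_{(t,y)} ∂₀` at every
`t`. [folklore] -/
theorem hasDerivAt_far_timeAxis (E : EndDatum Minkowski.spacetime)
    (hfar : ContMDiff 𝓘(ℝ, E4) (𝓡 4) ∞ E.far) {y : E3}
    (c : ℝ → Kerr.region (0 : ℝ) E.R) (hc : ∀ t, (c t : E4) = E4.ofTimeSpace t y) (t : ℝ) :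
    HasDerivAt (fun s ↦ (id (E.far (c s)) : E4))
      (id (mfderiv 𝓘(ℝ, E4) (𝓡 4) E.far (c t) (E4.basisVector 0)) : E4) t := by
  -- the underlying straight line `s ↦ (0, y) + s ∂₀`
  have hline : ∀ s : ℝ, E4.ofTimeSpace s y = E4.ofTimeSpace 0 y + s • E4.basisVector 0 := fun s ↦ by
    ext i
    refine Fin.cases ?_ (fun j ↦ ?_) i
    · simp [E4.basisVector]
    · simp [E4.basisVector, Fin.succ_ne_zero]
  have hcv : (Subtype.val ∘ c) = fun s : ℝ ↦ E4.ofTimeSpace 0 y + s • E4.basisVector 0 := by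
    funext s
    simp only [Function.comp_apply, hc s, hline s]
  have hp : ∀ s : ℝ, HasDerivAt (fun s : ℝ ↦ E4.ofTimeSpace 0 y + s • E4.basisVector 0) (E4.basisVector 0) s :=
    fun s ↦ by simpa using ((hasDerivAt_id s).smul_const (E4.basisVector 0)).const_add (E4.ofTimeSpace 0 y)
  have hp_smooth : ContMDiff 𝓘(ℝ, ℝ) 𝓘(ℝ, E4) ∞ (fun s : ℝ ↦ E4.ofTimeSpace 0 y + s • E4.basisVector 0) :=
    contMDiff_iff_contDiff.mpr (contDiff_const.add (contDiff_id.smul contDiff_const))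
  have hc_smooth : ContMDiff 𝓘(ℝ, ℝ) 𝓘(ℝ, E4) ∞ c :=
    (ContMDiff.subtypeVal_comp_iff (Kerr.region (0 : ℝ) E.R) c).mp (hcv ▸ hp_smooth)
  have hct : MDifferentiableAt 𝓘(ℝ, ℝ) 𝓘(ℝ, E4) c t := hc_smooth.mdifferentiableAt (by simp)
  have hΨt : MDifferentiableAt 𝓘(ℝ, E4) (𝓡 4) E.far (c t) := hfar.mdifferentiableAt (by simp)
  -- `dc_t = (1 ↦ ∂₀)`: two expressions for the differential of `Subtype.val ∘ c`
  have hpm : HasMFDerivAt 𝓘(ℝ, ℝ) 𝓘(ℝ, E4) (Subtype.val ∘ c) t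
      ((1 : ℝ →L[ℝ] ℝ).smulRight (E4.basisVector 0)) := by
    rw [hcv]
    exact (hasMFDerivAt_iff_hasFDerivAt (𝕜 := ℝ) (E := ℝ) (E' := E4)).2 (hp t).hasFDerivAt
  have hvc : HasMFDerivAt 𝓘(ℝ, ℝ) 𝓘(ℝ, E4) (Subtype.val ∘ c) t (mfderiv 𝓘(ℝ, ℝ) 𝓘(ℝ, E4) c t) :=
    ((hasMFDerivAt_subtypeVal (c t)).comp t hct.hasMFDerivAt).congr_mfderiv
      (ContinuousLinearMap.ext fun _ ↦ rfl)
  have hdc : mfderiv 𝓘(ℝ, ℝ) 𝓘(ℝ, E4) c t = (1 : ℝ →L[ℝ] ℝ).smulRight (E4.basisVector 0) :=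
    hvc.mfderiv.symm.trans hpm.mfderiv
  -- chain rule, then back to `HasDerivAt`
  have hcomp : HasMFDerivAt 𝓘(ℝ, ℝ) (𝓡 4) (E.far ∘ c) t
      ((mfderiv 𝓘(ℝ, E4) (𝓡 4) E.far (c t)).comp (mfderiv 𝓘(ℝ, ℝ) 𝓘(ℝ, E4) c t)) :=
    hΨt.hasMFDerivAt.comp t hct.hasMFDerivAt
  rw [hdc] at hcomp
  have hf := (hasMFDerivAt_iff_hasFDerivAt (𝕜 := ℝ) (E := ℝ) (E' := E4)).1 hcomp
  rw [hasDerivAt_iff_hasFDerivAt]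
  refine hf.congr_fderiv (ContinuousLinearMap.ext_ring ?_)
  change (mfderiv 𝓘(ℝ, E4) (𝓡 4) E.far (c t))
      ((ContinuousLinearMap.smulRight (1 : ℝ →L[ℝ] ℝ) (E4.basisVector 0) : ℝ → E4) 1) =
    ((ContinuousLinearMap.smulRight (1 : ℝ →L[ℝ] ℝ)
      (id (mfderiv 𝓘(ℝ, E4) (𝓡 4) E.far (c t) (E4.basisVector 0)) : E4)) : ℝ → E4) 1
  simp

/-- **Uniform timelikeness of the far-chart observer from the `C⁰` far bound.** For an end datum `E` of
Minkowski spacetime with `‖h(x)‖ · r ≤ C` on the far cylinder (`h = far^* η − g_{M,0}`), at every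
far point of radius `r ≥ 4 E.M + 2 C` the chart velocity `w = dfar ∂₀` satisfies
`η(w, w) = g_{M,0}(∂₀, ∂₀) + h(∂₀, ∂₀) = −(1 − 2M/r) + h₀₀ ≤ −1/2`. O'Neill 1983, Ch. 5, p. 145; Visser 2007,
(32)–(34). [cite: ONeill1983, Ch. 5, p. 145] -/
theorem bilin_mfderiv_far_le (E : EndDatum Minkowski.spacetime) {C : ℝ}
    (hC : ∀ x : Kerr.region (0 : ℝ) E.R, ‖E.h x.1‖ * Kerr.radius 0 x.1 ≤ C)
    (x : Kerr.region (0 : ℝ) E.R) (hx : 4 * E.M + 2 * C ≤ Kerr.radius 0 x.1) :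
    Minkowski.bilin (id (mfderiv 𝓘(ℝ, E4) (𝓡 4) E.far x (E4.basisVector 0)) : E4)
      (id (mfderiv 𝓘(ℝ, E4) (𝓡 4) E.far x (E4.basisVector 0)) : E4) ≤ -(1 / 2 : ℝ) := by
  have hr : 0 < Kerr.radius 0 x.1 := lt_of_le_of_lt (le_max_right _ _) (Kerr.mem_region.1 x.2)
  -- the deviation identity at `x`: `η(dfar ∂₀, dfar ∂₀) = h(x)(∂₀, ∂₀) + g_{M,0}(x)(∂₀, ∂₀)`
  have h1 : E.h x.1 = Minkowski.spacetime.deviation E.B E.far x := by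
    change Minkowski.spacetime.deviationExtend E.B E.far x.1 = _
    exact Spacetime.deviationExtend_coe _ _ _ _
  have hval : E.h x.1 (E4.basisVector 0) (E4.basisVector 0) =
      Minkowski.bilin (id (mfderiv 𝓘(ℝ, E4) (𝓡 4) E.far x (E4.basisVector 0)) : E4)
        (id (mfderiv 𝓘(ℝ, E4) (𝓡 4) E.far x (E4.basisVector 0)) : E4) -
        E.B.bilin x.1 (E4.basisVector 0) (E4.basisVector 0) := by
    rw [h1]
    rfl
  have hdev : Minkowski.bilin (id (mfderiv 𝓘(ℝ, E4) (𝓡 4) E.far x (E4.basisVector 0)) : E4)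
      (id (mfderiv 𝓘(ℝ, E4) (𝓡 4) E.far x (E4.basisVector 0)) : E4) =
        E.h x.1 (E4.basisVector 0) (E4.basisVector 0) + E.B.bilin x.1 (E4.basisVector 0) (E4.basisVector 0) := by
    rw [hval, sub_add_cancel]
  -- `g_{M,0}(∂₀, ∂₀) = −1 + 2M/r`
  have hKS : E.B.bilin x.1 (E4.basisVector 0) (E4.basisVector 0) = -1 + 2 * (E.M / Kerr.radius 0 x.1) := by
    change Kerr.bilin E.M 0 x.1 (E4.basisVector 0) (E4.basisVector 0) = _
    rw [Kerr.bilin_apply, Kerr.nullCovector_basisVector_zero, Minkowski.bilin_basisVector_zero_left]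
    have hH : Kerr.scalarH E.M 0 x.1 = E.M / Kerr.radius 0 x.1 := by
      unfold Kerr.scalarH
      have hr0 : Kerr.radius 0 x.1 ≠ 0 := hr.ne'
      field_simp
      ring
    rw [hH]
    simp
  -- `h₀₀ ≤ ‖h(x)‖ ≤ C / r`
  have hh : E.h x.1 (E4.basisVector 0) (E4.basisVector 0) ≤ C / Kerr.radius 0 x.1 := by
    have h1 : E.h x.1 (E4.basisVector 0) (E4.basisVector 0) ≤ ‖E.h x.1‖ := by
      have h2 := (E.h x.1).le_opNorm₂ (E4.basisVector 0) (E4.basisVector 0)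
      have hn : ‖(E4.basisVector 0 : E4)‖ = 1 := by simp [E4.basisVector]
      rw [hn, mul_one, mul_one, Real.norm_eq_abs] at h2
      exact (le_abs_self _).trans h2
    have h3 : ‖E.h x.1‖ ≤ C / Kerr.radius 0 x.1 := by
      rw [le_div_iff₀ hr]
      exact hC x
    exact h1.trans h3
  -- `2M/r + C/r ≤ 1/2`
  have hsum : 2 * (E.M / Kerr.radius 0 x.1) + C / Kerr.radius 0 x.1 ≤ 1 / 2 := by
    rw [show 2 * (E.M / Kerr.radius 0 x.1) + C / Kerr.radius 0 x.1 = (2 * E.M + C) / Kerr.radius 0 x.1 by ring,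
      div_le_iff₀ hr]
    linarith
  rw [hdev, hKS]
  linarith

/-- **(G6) from ONE slowly drifting far-chart observer (Minkowski spacetime).** Let `E` be an end datum of
`(ℝ⁴, η, ∂ₜ)` with smooth far chart, `far_* ∂₀` future-directed, and `‖h‖ · r ≤ C` on the far cylinder.
If at some radius `‖y‖ ≥ 4 E.M + 2 C` (inside the cylinder) the chart velocity `dfar_{(t,y)} ∂₀` grows at most
LINEARLY in chart time `t ≥ 0`, then the retarded time is unbounded on the far chart, so `E.horizon = ∅`, the
black-hole region of `range E.far` is empty, and `E.doc = I⁺(range E.far)`. O'Neill 1983, Ch. 14, pp. 402–403;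
Wald 1984, §12.1. [cite: Wald1984, §12.1] -/
theorem horizon_eq_empty_of_linear_frame_growth (E : EndDatum Minkowski.spacetime)
    (hfar : ContMDiff 𝓘(ℝ, E4) (𝓡 4) ∞ E.far)
    (hfut : ∀ x : Kerr.region (0 : ℝ) E.R, Minkowski.spacetime.timeOrientation.IsFutureDirected
      (mfderiv 𝓘(ℝ, E4) (𝓡 4) E.far x (E4.basisVector 0)))
    {C : ℝ} (hC : ∀ x : Kerr.region (0 : ℝ) E.R, ‖E.h x.1‖ * Kerr.radius 0 x.1 ≤ C)
    {y : E3} (hy : max E.R 0 < ‖y‖) (hyC : 4 * E.M + 2 * C ≤ ‖y‖) {K : ℝ} (hK : 0 < K)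
    (hgr : ∀ x : Kerr.region (0 : ℝ) E.R, E4.spatial x.1 = y → 0 ≤ x.1 0 →
      ‖(id (mfderiv 𝓘(ℝ, E4) (𝓡 4) E.far x (E4.basisVector 0)) : E4)‖ ≤ K * (1 + x.1 0)) :
    E.horizon = ∅ ∧ Minkowski.spacetime.blackHoleRegionOfEnd (Set.range E.far) = ∅ ∧
      E.doc = LorentzianMetric.chronologicalFuture (LorentzianMetric.ofLE (n' := (∞ : ℕ∞ω)) Minkowski.metric le_top)
        (TimeOrientation.ofLE (n' := (∞ : ℕ∞ω)) Minkowski.timeOrientation le_top) (Set.range E.far) := by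
  -- the lifted time axis at `y`
  have hmem : ∀ t : ℝ, E4.ofTimeSpace t y ∈ Kerr.region (0 : ℝ) E.R := fun t ↦ by
    rw [Kerr.mem_region, Kerr.radius_zero_left, E4.spatialNorm_ofTimeSpace]
    exact hy
  set c : ℝ → Kerr.region (0 : ℝ) E.R := fun t ↦ ⟨E4.ofTimeSpace t y, hmem t⟩ with hc_def
  have hc : ∀ t, (c t : E4) = E4.ofTimeSpace t y := fun t ↦ rfl
  set w : ℝ → E4 := fun t ↦ (id (mfderiv 𝓘(ℝ, E4) (𝓡 4) E.far (c t) (E4.basisVector 0)) : E4) with hw_def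
  have hγ : ∀ t, HasDerivAt (fun s ↦ (id (E.far (c s)) : E4)) (w t) t :=
    fun t ↦ hasDerivAt_far_timeAxis E hfar c hc t
  have hrad : ∀ t, Kerr.radius 0 (c t).1 = ‖y‖ := fun t ↦ by
    rw [Kerr.radius_zero_left, hc, E4.spatialNorm_ofTimeSpace]
  have hbil : ∀ t, 0 ≤ t → Minkowski.bilin (w t) (w t) ≤ -(1 / 2 : ℝ) := fun t _ ↦
    bilin_mfderiv_far_le E hC (c t) (by rw [hrad]; exact hyC)
  have h0 : ∀ t, 0 ≤ t → 0 ≤ w t 0 := fun t _ ↦ by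
    have h := (hfut (c t)).2
    change Minkowski.bilin (E4.basisVector 0) (w t) < 0 at h
    rw [Minkowski.bilin_basisVector_zero_left] at h
    linarith
  have hgr' : ∀ t, 0 ≤ t → ‖w t‖ ≤ K * (1 + t) := fun t ht ↦ by
    have h := hgr (c t) (by rw [hc, E4.spatial_ofTimeSpace]) (by rw [hc, E4.ofTimeSpace_apply_zero]; exact ht)
    rwa [hc, E4.ofTimeSpace_apply_zero] at h
  have hcrit := forall_exists_lt_of_linear_growth hγ (by norm_num : (0 : ℝ) < 1 / 2) hK hbil h0 hgr'
  refine horizon_eq_empty_minkowski E fun a ↦ ?_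
  obtain ⟨T, -, hT⟩ := hcrit a
  exact ⟨E.far (c T), ⟨c T, rfl⟩, hT⟩

/-- **(G6) from ONE slowly drifting observer of a TAME end of Minkowski spacetime (registered sub-goal
`flatHorizonLag` of stmt-FinalStateConjecture-17430).** For `E.IsTameEnd Λ r₀` (smooth injective far chart, `far_* ∂₀`
future, `0 ≤ M`, `‖D^m h‖ · r ≤ C` for `m ≤ 3`): if at ONE radius `‖y‖ ≥ 4 E.M + 2 E.C` in the far cylinder the
Lorentz factor of the chart observer `t ↦ E.far (t, y)` grows at most linearly in chart time `t ≥ 0`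
(`‖dfar_{(t,y)} ∂₀‖ ≤ K (1 + t)`; `id` retypes the tangent vector as a vector of `E4`), then `E.horizon = ∅` and the
black-hole region of `range E.far` is empty. Hence a flat element violating (G6) must have EVERY far-chart
observer accelerating with `∫ dt / ‖dfar ∂₀‖ < ∞`. Wald 1984, §12.1; Rindler 2006, §3.8. [cite: Wald1984, §12.1] -/
theorem flatHorizonLag : ∀ (E : EndDatum Minkowski.spacetime) (Λ : ℝ≥0) (r₀ : ℝ), E.IsTameEnd Λ r₀ → ∀ (y : E3), max E.R 0 < ‖y‖ → 4 * E.M + 2 * E.C ≤ ‖y‖ → ∀ (K : ℝ), 0 < K → (∀ x : Kerr.region (0 : ℝ) E.R, E4.spatial x.1 = y → 0 ≤ x.1 0 → ‖(id (mfderiv 𝓘(ℝ, E4) (𝓡 4) E.far x (E4.basisVector 0)) : E4)‖ ≤ K * (1 + x.1 0)) → E.horizon = ∅ ∧ Minkowski.spacetime.blackHoleRegionOfEnd (Set.range E.far) = ∅ := by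
  intro E Λ r₀ hE y hy hyC K hK hgr
  have hfar : ContMDiff 𝓘(ℝ, E4) (𝓡 4) ∞ E.far := hE.far_isLocalDiffeomorph.contMDiff
  have hC : ∀ x : Kerr.region (0 : ℝ) E.R, ‖E.h x.1‖ * Kerr.radius 0 x.1 ≤ E.C := fun x ↦ by
    have h := hE.far_bound 0 (by norm_num) x
    rwa [norm_iteratedFDeriv_zero] at h
  have h := horizon_eq_empty_of_linear_frame_growth E hfar hE.far_future hC hy hyC hK hgr
  exact ⟨h.1, h.2.1⟩

end Ends

end Summit.FinalStateConjecture.FinalStateConjecture.Theorems.TameLaSalle.FlatHorizon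

end
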